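import Literature.AlgebraicTopology.SingularHomology.StratumLocalHomology
import Literature.AlgebraicTopology.SingularHomology.ChartTransitionLocalDegree
import Literature.AlgebraicTopology.SingularHomology.OrientationCover
import Literature.AlgebraicTopology.SingularHomology.UniverseTransportIso
import HarnessLib

/-!
# Local classes of transverse discs at a straightened stratum of a space in any universe

Topic `Literature/AlgebraicTopology/SingularHomology`; second brick (after
`…StratumLocalHomology`) for the fact seat
`provefact-Literature.Topology.FourManifolds.Cobordism.Milnor1965_exists_isolatedPair_middle`, towards
the one-slide step of Milnor's Basis Theorem 7.6 on a slab (*Lectures on the h-cobordism theorem*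
(1965), PDF pp. 50–52; `HCobordismBasisInduction.lean`): the "easily proved relative version of
Lemma 6.3" of PDF p. 50 in homological form.  Setting: a space `X : Type u`, a subset `P ⊆ X`
(in the application: a right-hand disc `D_R(p_j)` in the slab), and a chart
`κ : X ⊇ source → ℝᵏ × G` **straightening `P`** (`x ∈ P ↔ (κ x).1 = (κ b).1` on the source;
`G` a real normed space).  A **transverse `k`-disc at `b ∈ P`** is the image `D = m(B̄(c, r))`
of a closed ball of `ℝᵏ` under a map `m` continuous and injective on the ball, with `m c = b`,
meeting `P` only at `b`, whose expression `κ ∘ m` in the chart has a first component with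
invertible derivative at `c`.  Main results:

* `localHomology.isIso_map_subsetIncl_of_mem_interior` — `Hₙ(S | c) ≅ Hₙ(X | c)` for every
  neighbourhood `S` of `c` (excision, Hatcher Thm. 2.20);
* `HomologicalOrientation.map_localClass_of_hasFDerivAt_fst_box` — the transverse-germ theorem
  of `…StratumLocalHomology` with values in an open box `O × B`, `O ⊆ ℝᵏ` open, `B` contractible;
* `exists_homeomorph_image_closedBall`, `exists_isGenerator_localHomology_parametrizedDisc` —
  a map continuous and injective on `B̄(c, r)` is a homeomorphism onto its image `D`, and
  `Hₖ(D | m c; ℤ)` has a generator (transport across universes, `…UniverseTransportIso`);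
* **`exists_ref_forall_transverseDisc`** — the main theorem: a reference class
  `REF ∈ Hₖ(X | P; ℤ)` of the chart (the flat class) such that EVERY transverse `k`-disc in a
  product box of the chart, with any generator of its local homology at the centre, has image
  `± REF` in `Hₖ(X | P; ℤ) = Hₖ(X, X ∖ P; ℤ)`;
* `map_generator_eq_or_eq_neg_of_transverseDiscs` — hence two transverse discs have the same
  class up to sign; `map_generator_eq_or_eq_neg_of_flatDiscs` — in particular the flat discs
  `κ⁻¹(B̄(q, r) × {g₀})`, `κ⁻¹(B̄(q, r') × {g₀'})` at two points of the stratum (the flat slice is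
  a transverse disc: `flatSlice_mem`, `fst_flatSlice`, `continuousOn_flatSlice`,
  `injOn_flatSlice`, `hasFDerivAt_fst_flatSlice`).

In Milnor's proof these are the facts *"`D_R(p_j) · D_L(p_i) = δ_{ij}`"* read near `p_j` in a
Morse chart, and *"`D_L'(p_1)` intersects `D_R(p_2)` in a single point, transversally"* read in
the chart of Lemma 7.7; here they take the form needed by the tree's homological statement of
Thm. 7.6 (`Literature.Topology.FourManifolds.Cobordism.Milnor1965_basisTheorem_slab`).
Everything is proved; no definitions, no named facts.

## References

* J. Milnor, *Lectures on the h-cobordism theorem*, notes by L. Siebenmann and J. Sondow,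
  Princeton Mathematical Notes (1965), proof of Thm. 7.6 (PDF pp. 50–52), Lemma 6.3 (PDF p. 36).
  Held: `lit read book:milnornd-lectures-h-cobordism-theorem`. [MilnorHCobordism1965]
* A. Hatcher, *Algebraic Topology*, CUP 2002, §2.1 Prop. 2.19, Thm. 2.20, §3.3 pp. 231–236.
  [HatcherAT2002]
* G. E. Bredon, *Topology and Geometry*, GTM 139, Springer 1993, VI.11. [Bredon1993]
-/

noncomputable section

open CategoryTheory Set Function Topology Metric Filter

universe u v w

namespace Literature.AlgebraicTopology.SingularHomology

variable (R : Type v) [CommRing R] (M : Type v) [AddCommGroup M] [Module R M]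

/-! ### Generators of infinite cyclic groups: transport -/

section Generators

variable {N : Type*} [AddCommGroup N] [Module ℤ N] {N' : Type*} [AddCommGroup N'] [Module ℤ N']

/-- Along a linear equivalence, the image of a generator is `±` any given generator of the
target. [folklore] -/
theorem map_eq_or_eq_neg_of_isGenerator (φ : N ≃ₗ[ℤ] N') {a : N} {b : N'}
    (ha : ∃ e : N ≃ₗ[ℤ] ℤ, e a = 1) (hb : ∃ e : N' ≃ₗ[ℤ] ℤ, e b = 1) :
    φ a = b ∨ φ a = -b :=
  eq_or_eq_neg_of_isGenerator (exists_linearEquiv_apply_eq_one_of_linearEquiv φ ha) hb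

omit [Module ℤ N] in
/-- If `a = b ∨ a = -b` and `b = c ∨ b = -c` then `a = c ∨ a = -c`. [folklore] -/
theorem eq_or_eq_neg_trans {a b c : N} (h₁ : a = b ∨ a = -b) (h₂ : b = c ∨ b = -c) :
    a = c ∨ a = -c := by
  rcases h₁ with rfl | rfl <;> rcases h₂ with rfl | rfl <;> simp

omit [Module ℤ N] in
/-- If `a = c ∨ a = -c` and `b = c ∨ b = -c` then `a = b ∨ a = -b`. [folklore] -/
theorem eq_or_eq_neg_of_common {a b c : N} (h₁ : a = c ∨ a = -c) (h₂ : b = c ∨ b = -c) :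
    a = b ∨ a = -b := by
  rcases h₁ with rfl | rfl <;> rcases h₂ with rfl | rfl <;> simp

/-- A `ℤ`-linear map sends `±`-related elements to `±`-related elements. [folklore] -/
theorem eq_or_eq_neg_map {N'' : Type*} [AddCommGroup N''] [Module ℤ N''] (f : N →ₗ[ℤ] N'')
    {a b : N} (h : a = b ∨ a = -b) : f a = f b ∨ f a = -f b := by
  rcases h with rfl | rfl
  · exact Or.inl rfl
  · exact Or.inr (map_neg f b)

end Generators

/-! ### Excision at a point for an arbitrary neighbourhood -/

section Neighbourhood

variable {X : Type u} [TopologicalSpace X]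

/-- **`Hₙ(S | c) ≅ Hₙ(X | c)` for every neighbourhood `S` of `c`** (not necessarily open): the
interiors of `X ∖ {c}` and of `S` cover `X`, so this is the excision theorem (Hatcher 2002,
Thm. 2.20; §3.3 p. 231). [cite: HatcherAT2002, Thm. 2.20] -/
theorem localHomology.isIso_map_subsetIncl_of_mem_interior [T1Space X] {S : Set X} {c : X}
    (hc : c ∈ interior S) (k : ℕ) :
    IsIso (relativeSingularHomology.map R M (subsetIncl S)
      (localHomology.mapsTo_subsetIncl_compl (interior_subset hc)) k) := by
  have hcS : c ∈ S := interior_subset hc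
  have hcov : interior ({c}ᶜ : Set X) ∪ interior S = Set.univ := by
    rw [(isOpen_compl_singleton (x := c)).interior_eq]
    refine Set.eq_univ_of_forall fun y => ?_
    by_cases hy : y = c
    · exact Or.inr (hy ▸ hc)
    · exact Or.inl (Set.mem_compl_singleton_iff.mpr hy)
  have h1 := relativeSingularHomology.isIso_map_of_interior_union_interior_holds R M X {c}ᶜ S hcov k
  have heq : ({(⟨c, hcS⟩ : S)}ᶜ : Set S) = Subtype.val ⁻¹' {c}ᶜ := by
    ext y
    simp only [Set.mem_compl_iff, Set.mem_singleton_iff, Set.mem_preimage, Subtype.ext_iff]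
  have hid : Set.MapsTo (ContinuousMap.id S) ({(⟨c, hcS⟩ : S)}ᶜ : Set S) (Subtype.val ⁻¹' {c}ᶜ) :=
    fun y hy => heq ▸ hy
  haveI := relativeSingularHomology.isIso_map_id_of_eq R M heq hid k
  have hfac : relativeSingularHomology.map R M (subsetIncl S)
      (localHomology.mapsTo_subsetIncl_compl hcS) k =
      relativeSingularHomology.map R M (ContinuousMap.id S) hid k ≫
        relativeSingularHomology.map R M (subsetIncl S) (Set.mapsTo_preimage Subtype.val {c}ᶜ) k := by
    rw [← relativeSingularHomology.map_comp]
    rfl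
  rw [hfac]
  haveI := h1
  infer_instance

/-- **An inclusion `S ⊆ T` of two neighbourhoods of `c` induces `Hₙ(S | c) ≅ Hₙ(T | c)`** (both
are `≅ Hₙ(X | c)` by excision). [cite: HatcherAT2002, Thm. 2.20] -/
theorem localHomology.isIso_map_subsetInclusion_of_mem_interior [T1Space X] {S T : Set X}
    (hST : S ⊆ T) {c : X} (hc : c ∈ interior S) (k : ℕ)
    (h : MapsTo (subsetInclusion hST) {(⟨c, interior_subset hc⟩ : S)}ᶜ
      {(⟨c, hST (interior_subset hc)⟩ : T)}ᶜ) :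
    IsIso (relativeSingularHomology.map R M (subsetInclusion hST) h k) := by
  have hcT : c ∈ interior T := interior_mono hST hc
  have hfac : relativeSingularHomology.map R M (subsetInclusion hST) h k ≫
      relativeSingularHomology.map R M (subsetIncl T)
        (localHomology.mapsTo_subsetIncl_compl (interior_subset hcT)) k =
      relativeSingularHomology.map R M (subsetIncl S)
        (localHomology.mapsTo_subsetIncl_compl (interior_subset hc)) k := by
    rw [← relativeSingularHomology.map_comp]
    rfl
  haveI := localHomology.isIso_map_subsetIncl_of_mem_interior R M hc k
  haveI := localHomology.isIso_map_subsetIncl_of_mem_interior R M hcT k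
  exact IsIso.of_isIso_fac_right hfac

end Neighbourhood


/-! ### The local class of a transverse germ, with values in an open box `O × B` -/

section TransverseBox

variable {k : ℕ} {B : Type} [TopologicalSpace B]

/-- **Transverse germs, box form.**  As `HomologicalOrientation.map_localClass_of_hasFDerivAt_fst`
(`…StratumLocalHomology`), for a germ `F : (V, p) → (O × B, {q} × B)` with values in the product
of an open `O ⊆ ℝᵏ` and a contractible `B`, whose first component is (the restriction of) a map
`t` with `t p = q` and invertible derivative at `p`: `F_*` sends the local orientation class at
`p` to `±` the flat class at `q`, the sign being that of the Jacobian.  (Project to `O`, include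
`O` into `ℝᵏ` — both isomorphisms on local homology — and apply the local degree theorem
`HomologicalOrientation.localDegree_of_hasFDerivAt`.) [cite: HatcherAT2002, §3.3 p. 233 and §2.2 Exercise 7; Bredon1993, VI.11] -/
theorem HomologicalOrientation.map_localClass_of_hasFDerivAt_fst_box [ContractibleSpace B]
    (g : HomologicalOrientation ℤ (EuclideanSpace ℝ (Fin k)) k)
    {O : Set (EuclideanSpace ℝ (Fin k))} (hO : IsOpen O)
    {V : Set (EuclideanSpace ℝ (Fin k))} (hV : IsOpen V) {p : EuclideanSpace ℝ (Fin k)} (hp : p ∈ V)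
    (F : C(↥V, ↥O × B)) (t : EuclideanSpace ℝ (Fin k) → EuclideanSpace ℝ (Fin k))
    (htc : ContinuousOn t V) (hFt : ∀ v : ↥V, ((F v).1 : EuclideanSpace ℝ (Fin k)) = t v)
    {L : EuclideanSpace ℝ (Fin k) →L[ℝ] EuclideanSpace ℝ (Fin k)} (ht : HasFDerivAt t L p)
    (hL : LinearMap.det (L : EuclideanSpace ℝ (Fin k) →ₗ[ℝ] EuclideanSpace ℝ (Fin k)) ≠ 0)
    {q : EuclideanSpace ℝ (Fin k)} (hq : t p = q) (hqO : q ∈ O)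
    (h : MapsTo F {(⟨p, hp⟩ : ↥V)}ᶜ ((({⟨q, hqO⟩} : Set ↥O) ×ˢ (univ : Set B))ᶜ)) :
    relativeSingularHomology.map ℤ ℤ F h k
        ((localHomology.openSubsetIso ℤ ℤ hV hp k).inv (g.localClass p)) =
      relativeSingularHomology.map ℤ ℤ ((ContinuousMap.id ↥O).prodMk (ContinuousMap.const ↥O (F ⟨p, hp⟩).2))
        (mapsTo_prodSlice_compl_prod {(⟨q, hqO⟩ : ↥O)} (F ⟨p, hp⟩).2) k
        (if 0 < LinearMap.det (L : EuclideanSpace ℝ (Fin k) →ₗ[ℝ] EuclideanSpace ℝ (Fin k))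
          then (localHomology.openSubsetIso ℤ ℤ hO hqO k).inv (g.localClass q)
          else -(localHomology.openSubsetIso ℤ ℤ hO hqO k).inv (g.localClass q)) := by
  -- `Φ = incl_* ∘ fst_*` is injective
  have hι := localHomology.mapsTo_subsetIncl_compl (X := EuclideanSpace ℝ (Fin k)) hqO
  have hinj : Injective (relativeSingularHomology.map ℤ ℤ (ContinuousMap.fst : C(↥O × B, ↥O))
      (mapsTo_fst_compl_prod {(⟨q, hqO⟩ : ↥O)}) k ≫
      relativeSingularHomology.map ℤ ℤ (subsetIncl O) hι k) := by
    haveI := localHomologyOfSet.isIso_map_fst_prod ℤ ℤ (B := B) ({(⟨q, hqO⟩ : ↥O)} : Set ↥O) k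
    haveI := localHomology.isIso_map_subsetIncl_of_isOpen ℤ ℤ hO hqO k
    exact (asIso (relativeSingularHomology.map ℤ ℤ (ContinuousMap.fst : C(↥O × B, ↥O))
      (mapsTo_fst_compl_prod {(⟨q, hqO⟩ : ↥O)}) k ≫
      relativeSingularHomology.map ℤ ℤ (subsetIncl O) hι k)).toLinearEquiv.injective
  apply hinj
  -- the left-hand side: `incl ∘ fst ∘ F = t|V`, then the local degree theorem
  have htm : MapsTo (fun v : ↥V => t v) {(⟨p, hp⟩ : ↥V)}ᶜ {q}ᶜ := by
    intro v hv htv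
    refine h hv ⟨?_, mem_univ _⟩
    have : ((F v).1 : EuclideanSpace ℝ (Fin k)) = q := (hFt v).trans htv
    exact Subtype.ext this
  have e1 : relativeSingularHomology.map ℤ ℤ F h k ≫
      (relativeSingularHomology.map ℤ ℤ (ContinuousMap.fst : C(↥O × B, ↥O))
        (mapsTo_fst_compl_prod {(⟨q, hqO⟩ : ↥O)}) k ≫
        relativeSingularHomology.map ℤ ℤ (subsetIncl O) hι k) =
      relativeSingularHomology.map ℤ ℤ
        (⟨fun v : ↥V => t v, htc.restrict⟩ : C(↥V, EuclideanSpace ℝ (Fin k))) htm k := by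
    rw [← relativeSingularHomology.map_comp, ← relativeSingularHomology.map_comp]
    exact relativeSingularHomology.map_congr ℤ ℤ (ContinuousMap.ext fun v => hFt v) _ _ k
  -- the right-hand side: `incl ∘ fst ∘ slice = incl`
  have e2 : relativeSingularHomology.map ℤ ℤ
        ((ContinuousMap.id ↥O).prodMk (ContinuousMap.const ↥O (F ⟨p, hp⟩).2))
        (mapsTo_prodSlice_compl_prod {(⟨q, hqO⟩ : ↥O)} (F ⟨p, hp⟩).2) k ≫
      (relativeSingularHomology.map ℤ ℤ (ContinuousMap.fst : C(↥O × B, ↥O))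
        (mapsTo_fst_compl_prod {(⟨q, hqO⟩ : ↥O)}) k ≫
        relativeSingularHomology.map ℤ ℤ (subsetIncl O) hι k) =
      relativeSingularHomology.map ℤ ℤ (subsetIncl O) hι k := by
    rw [← Category.assoc, localHomologyOfSet.map_prodSlice_comp_map_fst, Category.id_comp]
  have e3 : relativeSingularHomology.map ℤ ℤ (subsetIncl O) hι k
      ((localHomology.openSubsetIso ℤ ℤ hO hqO k).inv (g.localClass q)) = g.localClass q := by
    rw [← ModuleCat.comp_apply]
    change ((localHomology.openSubsetIso ℤ ℤ hO hqO k).inv ≫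
      (localHomology.openSubsetIso ℤ ℤ hO hqO k).hom) (g.localClass q) = g.localClass q
    rw [Iso.inv_hom_id, ModuleCat.id_apply]
  have lhs := congrArg (fun φ => φ ((localHomology.openSubsetIso ℤ ℤ hV hp k).inv (g.localClass p))) e1
  have rhs := congrArg (fun φ => φ
    (if 0 < LinearMap.det (L : EuclideanSpace ℝ (Fin k) →ₗ[ℝ] EuclideanSpace ℝ (Fin k))
      then (localHomology.openSubsetIso ℤ ℤ hO hqO k).inv (g.localClass q)
      else -(localHomology.openSubsetIso ℤ ℤ hO hqO k).inv (g.localClass q))) e2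
  simp only [ModuleCat.comp_apply] at lhs rhs ⊢
  rw [lhs, rhs, g.localDegree_of_hasFDerivAt t hV hp htc ht hL hq htm]
  split_ifs
  · exact e3.symm
  · rw [map_neg, e3]

end TransverseBox


/-! ### Parametrized closed discs: the homeomorphism with the ball, generators at the centre -/

section Disc

variable {k : ℕ} {Z : Type w} [TopologicalSpace Z]

/-- A map continuous and injective on a closed ball of `ℝᵏ`, with values in a Hausdorff space,
is a homeomorphism of the ball onto its image (a continuous bijection from a compact space to a
Hausdorff space). [folklore] -/
theorem exists_homeomorph_image_closedBall [T2Space Z] (m : EuclideanSpace ℝ (Fin k) → Z)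
    {c : EuclideanSpace ℝ (Fin k)} {r : ℝ} (hmc : ContinuousOn m (closedBall c r))
    (hmi : InjOn m (closedBall c r)) :
    ∃ e : ↥(closedBall c r) ≃ₜ ↥(m '' closedBall c r), ∀ v, (e v : Z) = m v := by
  haveI : CompactSpace ↥(closedBall c r) :=
    isCompact_iff_compactSpace.mp (isCompact_closedBall c r)
  have hc : Continuous ((closedBall c r).restrict m) := hmc.restrict
  have hi : Injective ((closedBall c r).restrict m) := hmi.injective
  have hemb : IsClosedEmbedding ((closedBall c r).restrict m) := hc.isClosedEmbedding hi
  have hr : range ((closedBall c r).restrict m) = m '' closedBall c r := by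
    rw [range_restrict]
  exact ⟨hemb.isEmbedding.toHomeomorph.trans (Homeomorph.setCongr hr), fun v => rfl⟩

/-- **The local orientation class of an open ball, included in the closed ball, generates
`Hₖ(B̄(c, r) | c; ℤ)`**: every generator of `Hₖ(B̄(c, r) | c; ℤ)` is `±` the image of
`g_c` (excised to the open ball `B(c, r)`) under the inclusion `B(c, r) ⊆ B̄(c, r)`, which is an
isomorphism on local homology at the centre (excision). [cite: HatcherAT2002, Thm. 2.20, §3.3 p. 231] -/
theorem eq_or_eq_neg_map_inclusion_ball_of_isGenerator
    (g : HomologicalOrientation ℤ (EuclideanSpace ℝ (Fin k)) k) {c : EuclideanSpace ℝ (Fin k)} {r : ℝ} (hr : 0 < r)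
    (hι : MapsTo (subsetInclusion (ball_subset_closedBall : ball c r ⊆ closedBall c r))
      {(⟨c, mem_ball_self hr⟩ : ↥(ball c r))}ᶜ {(⟨c, mem_closedBall_self hr.le⟩ : ↥(closedBall c r))}ᶜ)
    {γ₀ : localHomology ℤ ℤ ↥(closedBall c r) ⟨c, mem_closedBall_self hr.le⟩ k}
    (hγ₀ : ∃ e : _ ≃ₗ[ℤ] ℤ, e γ₀ = 1) :
    γ₀ = relativeSingularHomology.map ℤ ℤ (subsetInclusion ball_subset_closedBall) hι k
        ((localHomology.openSubsetIso ℤ ℤ isOpen_ball (mem_ball_self hr) k).inv (g.localClass c)) ∨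
    γ₀ = -relativeSingularHomology.map ℤ ℤ (subsetInclusion ball_subset_closedBall) hι k
        ((localHomology.openSubsetIso ℤ ℤ isOpen_ball (mem_ball_self hr) k).inv (g.localClass c)) := by
  -- `x_c` generates `Hₖ(B(c, r) | c)`
  have hx : ∃ e : _ ≃ₗ[ℤ] ℤ,
      e ((localHomology.openSubsetIso ℤ ℤ isOpen_ball (mem_ball_self hr) k).inv (g.localClass c)) = 1 := by
    obtain ⟨e, he⟩ := g.isGenerator c
    refine ⟨(localHomology.openSubsetIso ℤ ℤ isOpen_ball (mem_ball_self hr) k).toLinearEquiv.trans e, ?_⟩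
    rw [LinearEquiv.trans_apply, Iso.toLinearEquiv_apply, ← ModuleCat.comp_apply, Iso.inv_hom_id,
      ModuleCat.id_apply, he]
  -- the inclusion of the open ball in the closed ball is an isomorphism at the centre
  have hc : c ∈ interior (ball c r) := by
    rw [isOpen_ball.interior_eq]
    exact mem_ball_self hr
  haveI := localHomology.isIso_map_subsetInclusion_of_mem_interior ℤ ℤ
    (ball_subset_closedBall : ball c r ⊆ closedBall c r) hc k hι
  exact eq_or_eq_neg_of_isGenerator hγ₀ (exists_linearEquiv_apply_eq_one_of_linearEquiv
    (asIso (relativeSingularHomology.map ℤ ℤ (subsetInclusion ball_subset_closedBall) hι k)).toLinearEquiv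
    hx)

/-- **`Hₖ(D | b; ℤ)` is infinite cyclic for a parametrized closed `k`-disc** `D = m(B̄(c, r))`,
`b = m c` (`m` continuous and injective on the ball, values in a Hausdorff space): there is a
generator. (Transport of `g_c` along the homeomorphism `B̄(c, r) ≃ D` across universes,
`…UniverseTransportIso`, and excision.) [cite: HatcherAT2002, §3.3 p. 231, Thm. 2.20] -/
theorem exists_isGenerator_localHomology_parametrizedDisc [T2Space Z] (m : EuclideanSpace ℝ (Fin k) → Z)
    {c : EuclideanSpace ℝ (Fin k)} {r : ℝ} (hr : 0 < r) (hmc : ContinuousOn m (closedBall c r))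
    (hmi : InjOn m (closedBall c r)) :
    ∃ γ : localHomology ℤ ℤ ↥(m '' closedBall c r)
        ⟨m c, mem_image_of_mem m (mem_closedBall_self hr.le)⟩ k,
      ∃ e : _ ≃ₗ[ℤ] ℤ, e γ = 1 := by
  obtain ⟨g⟩ := isOrientableOver_of_simplyConnectedSpace ℤ (EuclideanSpace ℝ (Fin k)) (n := k)
  obtain ⟨e, he⟩ := exists_homeomorph_image_closedBall m hmc hmi
  have hec : e ⟨c, mem_closedBall_self hr.le⟩ =
      ⟨m c, mem_image_of_mem m (mem_closedBall_self hr.le)⟩ := Subtype.ext (he _)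
  -- a generator of `Hₖ(B̄ | c)`: the class `x_c` pushed from the open ball
  have hι : MapsTo (subsetInclusion (ball_subset_closedBall : ball c r ⊆ closedBall c r))
      {(⟨c, mem_ball_self hr⟩ : ↥(ball c r))}ᶜ {(⟨c, mem_closedBall_self hr.le⟩ : ↥(closedBall c r))}ᶜ :=
    fun v hv h => hv (Subtype.ext (congrArg Subtype.val h :))
  have hc : c ∈ interior (ball c r) := by
    rw [isOpen_ball.interior_eq]
    exact mem_ball_self hr
  haveI := localHomology.isIso_map_subsetInclusion_of_mem_interior ℤ ℤ
    (ball_subset_closedBall : ball c r ⊆ closedBall c r) hc k hι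
  have hx : ∃ e : _ ≃ₗ[ℤ] ℤ,
      e ((localHomology.openSubsetIso ℤ ℤ isOpen_ball (mem_ball_self hr) k).inv (g.localClass c)) = 1 := by
    obtain ⟨e, he⟩ := g.isGenerator c
    refine ⟨(localHomology.openSubsetIso ℤ ℤ isOpen_ball (mem_ball_self hr) k).toLinearEquiv.trans e, ?_⟩
    rw [LinearEquiv.trans_apply, Iso.toLinearEquiv_apply, ← ModuleCat.comp_apply, Iso.inv_hom_id,
      ModuleCat.id_apply, he]
  have hγ₀ := exists_linearEquiv_apply_eq_one_of_linearEquiv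
    (asIso (relativeSingularHomology.map ℤ ℤ (subsetInclusion ball_subset_closedBall) hι k)).toLinearEquiv
    hx
  -- transport along `e`
  have h1 := exists_linearEquiv_apply_eq_one_of_linearEquiv
    (localHomology.xEquiv ℤ ℤ e ⟨c, mem_closedBall_self hr.le⟩ k) hγ₀
  have key : ∀ (y : ↥(m '' closedBall c r)), e ⟨c, mem_closedBall_self hr.le⟩ = y →
      ∃ γ : localHomology ℤ ℤ ↥(m '' closedBall c r) y k, ∃ e' : _ ≃ₗ[ℤ] ℤ, e' γ = 1 := by
    rintro y rfl
    exact ⟨_, h1⟩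
  exact key _ hec

end Disc


/-! ### Transverse discs at a straightened stratum of a space in any universe -/

section Charts

variable {k : ℕ} {G : Type} [NormedAddCommGroup G] [NormedSpace ℝ G]
variable {X : Type u} [TopologicalSpace X]

omit [NormedSpace ℝ G] in
/-- In a chart `κ` straightening `P` (`x ∈ P ↔ (κ x).1 = q` on the source), a parametrized disc
`D = m(B̄(c, r))` lying in the source and meeting the level `(κ ·).1 = q` only at the centre
meets `P` only at `b = m c`: the inclusion `D ⊆ X` is a map of pairs `(D, D ∖ b) → (X, X ∖ P)`.
[folklore] -/
theorem mapsTo_subsetIncl_parametrizedDisc {P : Set X}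
    (κ : OpenPartialHomeomorph X (EuclideanSpace ℝ (Fin k) × G)) {q : EuclideanSpace ℝ (Fin k)}
    (hP : ∀ x ∈ κ.source, x ∈ P ↔ (κ x).1 = q) (m : EuclideanSpace ℝ (Fin k) → X) {c : EuclideanSpace ℝ (Fin k)} {r : ℝ}
    (hr : 0 < r) (hms : ∀ v ∈ closedBall c r, m v ∈ κ.source)
    (hmP : ∀ v ∈ closedBall c r, v ≠ c → (κ (m v)).1 ≠ q) :
    MapsTo (subsetIncl (m '' closedBall c r))
      {(⟨m c, mem_image_of_mem m (mem_closedBall_self hr.le)⟩ : ↥(m '' closedBall c r))}ᶜ Pᶜ := by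
  rintro ⟨_, v, hv, rfl⟩ hx hxP
  have hvc : v ≠ c := by
    rintro rfl
    exact hx rfl
  exact hmP v hv hvc ((hP _ (hms v hv)).1 hxP)

/-- **The reference class of a straightening chart, and the local class of every transverse
disc** (Milnor 1965, PDF p. 50, the "relative Lemma 6.3" in homological form; Bredon 1993, VI.11).
Let `κ : X ⊇ source → ℝᵏ × G` be a chart of a Hausdorff space `X` (any universe) straightening
`P ⊆ X` at the level `q` — `x ∈ P ↔ (κ x).1 = q` on the source — and fix a product box
`B(q, ρ) × B(g₁, ρ)` inside the target.  Then there is a class `REF ∈ Hₖ(X | P; ℤ)` such that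
for EVERY parametrized transverse `k`-disc `D = m(B̄(c, r))` in the box — `m` continuous and
injective on the closed ball, mapping it into `source ∩ κ⁻¹(box)`, with `(κ (m c)).1 = q`,
`(κ (m v)).1 ≠ q` for `v ≠ c`, and `v ↦ (κ (m v)).1` differentiable at `c` with invertible
derivative — and every generator `γ` of `Hₖ(D | m c; ℤ) ≅ ℤ`, the image of `γ` in `Hₖ(X | P; ℤ)`
is `REF` or `-REF`.  (`REF` is the flat class `κ⁻¹(· , g₁)_* g_q` of the chart; proof: transport
to the box `B(q, ρ) × B(g₁, ρ)` along `κ` across universes (`relativeSingularHomology.xEquiv_map`),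
where the class of `D` is computed by `HomologicalOrientation.map_localClass_of_hasFDerivAt_fst_box`
and all slices agree, `localHomologyOfSet.map_prodSlice_eq`.)
[cite: MilnorHCobordism1965, proof of Thm. 7.6 (PDF p. 50); HatcherAT2002, §3.3 pp. 231–236; Bredon1993, VI.11] -/
theorem exists_ref_forall_transverseDisc [T2Space X] {P : Set X}
    (κ : OpenPartialHomeomorph X (EuclideanSpace ℝ (Fin k) × G)) {q : EuclideanSpace ℝ (Fin k)}
    (hP : ∀ x ∈ κ.source, x ∈ P ↔ (κ x).1 = q) {ρ : ℝ} (hρ : 0 < ρ) {g₁ : G}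
    (hbox : ball q ρ ×ˢ ball g₁ ρ ⊆ κ.target) :
    ∃ REF : localHomologyOfSet ℤ ℤ X P k,
      ∀ (m : EuclideanSpace ℝ (Fin k) → X) (c : EuclideanSpace ℝ (Fin k)) (r : ℝ) (hr : 0 < r)
        (hmc : ContinuousOn m (closedBall c r)) (hmi : InjOn m (closedBall c r))
        (hmU : ∀ v ∈ closedBall c r, m v ∈ κ.source ∧ κ (m v) ∈ ball q ρ ×ˢ ball g₁ ρ)
        (hmq : (κ (m c)).1 = q) (hmP : ∀ v ∈ closedBall c r, v ≠ c → (κ (m v)).1 ≠ q)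
        (L : EuclideanSpace ℝ (Fin k) →L[ℝ] EuclideanSpace ℝ (Fin k)) (_ : HasFDerivAt (fun v => (κ (m v)).1) L c)
        (_ : LinearMap.det (L : EuclideanSpace ℝ (Fin k) →ₗ[ℝ] EuclideanSpace ℝ (Fin k)) ≠ 0)
        (γ : localHomology ℤ ℤ ↥(m '' closedBall c r)
          ⟨m c, mem_image_of_mem m (mem_closedBall_self hr.le)⟩ k)
        (_ : ∃ e : _ ≃ₗ[ℤ] ℤ, e γ = 1),
        relativeSingularHomology.map ℤ ℤ (subsetIncl (m '' closedBall c r))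
            (mapsTo_subsetIncl_parametrizedDisc κ hP m hr (fun v hv => (hmU v hv).1) hmP) k γ = REF ∨
        relativeSingularHomology.map ℤ ℤ (subsetIncl (m '' closedBall c r))
            (mapsTo_subsetIncl_parametrizedDisc κ hP m hr (fun v hv => (hmU v hv).1) hmP) k γ = -REF := by
  obtain ⟨g⟩ := isOrientableOver_of_simplyConnectedSpace ℤ (EuclideanSpace ℝ (Fin k)) (n := k)
  -- the box `Bx × W` and the open set `U = source ∩ κ⁻¹(Bx × W)`
  have hq : q ∈ ball q ρ := mem_ball_self hρ
  have hg₁ : g₁ ∈ ball g₁ ρ := mem_ball_self hρ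
  haveI : ContractibleSpace ↥(ball g₁ ρ) := (convex_ball g₁ ρ).contractibleSpace ⟨g₁, hg₁⟩
  let U : Set X := κ.source ∩ κ ⁻¹' (ball q ρ ×ˢ ball g₁ ρ)
  -- the homeomorphism `η : U ≃ Bx × W` across universes
  have hκc : Continuous fun x : ↥U => κ x.1 :=
    κ.continuousOn.comp_continuous continuous_subtype_val fun x => x.2.1
  have hy : ∀ p : ↥(ball q ρ) × ↥(ball g₁ ρ),
      ((p.1 : EuclideanSpace ℝ (Fin k)), (p.2 : G)) ∈ ball q ρ ×ˢ ball g₁ ρ := fun p => ⟨p.1.2, p.2.2⟩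
  have hsc : Continuous fun p : ↥(ball q ρ) × ↥(ball g₁ ρ) =>
      κ.symm ((p.1 : EuclideanSpace ℝ (Fin k)), (p.2 : G)) :=
    κ.continuousOn_symm.comp_continuous
      (continuous_subtype_val.fst'.prodMk continuous_subtype_val.snd') fun p => hbox (hy p)
  have hright : ∀ p : ↥(ball q ρ) × ↥(ball g₁ ρ),
      κ (κ.symm ((p.1 : EuclideanSpace ℝ (Fin k)), (p.2 : G))) = ((p.1 : EuclideanSpace ℝ (Fin k)), (p.2 : G)) :=
    fun p => κ.right_inv (hbox (hy p))
  have hmemU : ∀ p : ↥(ball q ρ) × ↥(ball g₁ ρ), κ.symm ((p.1 : EuclideanSpace ℝ (Fin k)), (p.2 : G)) ∈ U :=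
    fun p => ⟨κ.map_target (hbox (hy p)),
      Set.mem_preimage.mpr (Set.mem_of_eq_of_mem (hright p) (hy p))⟩
  let η : ↥U ≃ₜ ↥(ball q ρ) × ↥(ball g₁ ρ) :=
    { toFun := fun x => (⟨(κ x.1).1, x.2.2.1⟩, ⟨(κ x.1).2, x.2.2.2⟩)
      invFun := fun p => ⟨κ.symm ((p.1 : EuclideanSpace ℝ (Fin k)), (p.2 : G)), hmemU p⟩
      left_inv := fun x => Subtype.ext (κ.left_inv x.2.1)
      right_inv := fun p => by
        ext : 2
        · exact congrArg Prod.fst (hright p)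
        · exact congrArg Prod.snd (hright p)
      continuous_toFun := (hκc.fst.subtype_mk _).prodMk (hκc.snd.subtype_mk _)
      continuous_invFun := hsc.subtype_mk _ }
  -- pairs: `U ∖ P` corresponds to the complement of the stratum `{q} × W`
  have hAB : MapsTo η (Subtype.val ⁻¹' P : Set ↥U)ᶜ
      ((({⟨q, hq⟩} : Set ↥(ball q ρ)) ×ˢ (univ : Set ↥(ball g₁ ρ)))ᶜ) := by
    intro x hx hmem
    apply hx
    have h1 : (κ x.1).1 = q := by
      have := congrArg Subtype.val (mem_singleton_iff.1 hmem.1)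
      exact this
    exact (hP _ x.2.1).2 h1
  have hBA : MapsTo η.symm ((({⟨q, hq⟩} : Set ↥(ball q ρ)) ×ˢ (univ : Set ↥(ball g₁ ρ)))ᶜ)
      (Subtype.val ⁻¹' P : Set ↥U)ᶜ := by
    intro p hp hPmem
    apply hp
    refine ⟨?_, mem_univ _⟩
    have h1 : (κ (κ.symm ((p.1 : EuclideanSpace ℝ (Fin k)), (p.2 : G)))).1 = q :=
      (hP _ (κ.map_target (hbox (hy p)))).1 hPmem
    rw [hright p] at h1
    exact mem_singleton_iff.2 (Subtype.ext h1)
  have hUP : MapsTo (subsetIncl U) (Subtype.val ⁻¹' P : Set ↥U)ᶜ Pᶜ := fun x hx => hx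
  -- the reference class: the flat class of the slice at `g₁`, pulled back along `η` and pushed to `X`
  refine ⟨relativeSingularHomology.map ℤ ℤ (subsetIncl U) hUP k
    ((relativeSingularHomology.xEquiv ℤ ℤ η hAB hBA k).symm
      (relativeSingularHomology.map ℤ ℤ
        ((ContinuousMap.id ↥(ball q ρ)).prodMk (ContinuousMap.const ↥(ball q ρ) (⟨g₁, hg₁⟩ : ↥(ball g₁ ρ))))
        (mapsTo_prodSlice_compl_prod {(⟨q, hq⟩ : ↥(ball q ρ))} (⟨g₁, hg₁⟩ : ↥(ball g₁ ρ))) k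
        ((localHomology.openSubsetIso ℤ ℤ isOpen_ball hq k).inv (g.localClass q)))),
    fun m c r hr hmc hmi hmU hmq hmP L hder hL γ hγ => ?_⟩
  -- the disc `D ⊆ U`, its parametrization `e : B̄(c, r) ≃ D`, and the inclusion `f : D → U`
  have hDU : m '' closedBall c r ⊆ U := by
    rintro _ ⟨v, hv, rfl⟩
    exact ⟨(hmU v hv).1, (hmU v hv).2⟩
  obtain ⟨e, he⟩ := exists_homeomorph_image_closedBall m hmc hmi
  have hec : e ⟨c, mem_closedBall_self hr.le⟩ =
      ⟨m c, mem_image_of_mem m (mem_closedBall_self hr.le)⟩ := Subtype.ext (he _)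
  have hme : ∀ x : ↥(m '' closedBall c r), m (e.symm x) = x := fun x => by
    rw [← he, e.apply_symm_apply]
  have hf : MapsTo (subsetInclusion hDU)
      {(⟨m c, mem_image_of_mem m (mem_closedBall_self hr.le)⟩ : ↥(m '' closedBall c r))}ᶜ
      (Subtype.val ⁻¹' P : Set ↥U)ᶜ :=
    fun x hx => mapsTo_subsetIncl_parametrizedDisc κ hP m hr (fun v hv => (hmU v hv).1) hmP hx
  -- the disc in box coordinates
  have hκm : ContinuousOn (fun v => κ (m v)) (closedBall c r) :=
    κ.continuousOn.comp hmc fun v hv => (hmU v hv).1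
  let gm : C(↥(closedBall c r), ↥(ball q ρ) × ↥(ball g₁ ρ)) :=
    ⟨fun v => (⟨(κ (m v)).1, (hmU v v.2).2.1⟩, ⟨(κ (m v)).2, (hmU v v.2).2.2⟩),
      (hκm.restrict.fst.subtype_mk _).prodMk (hκm.restrict.snd.subtype_mk _)⟩
  have hgm : MapsTo gm {(⟨c, mem_closedBall_self hr.le⟩ : ↥(closedBall c r))}ᶜ
      ((({⟨q, hq⟩} : Set ↥(ball q ρ)) ×ˢ (univ : Set ↥(ball g₁ ρ)))ᶜ) := by
    intro v hv hmem
    have h1 : (κ (m v)).1 = q := congrArg Subtype.val (mem_singleton_iff.1 hmem.1)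
    exact hmP v v.2 (fun h => hv (Subtype.ext h)) h1
  have hsq : ∀ x : ↥(m '' closedBall c r), gm (e.symm x) = η (subsetInclusion hDU x) := by
    intro x
    ext : 2
    · change (κ (m (e.symm x))).1 = (κ x.1).1
      rw [hme]
    · change (κ (m (e.symm x))).2 = (κ x.1).2
      rw [hme]
  have hAB₁ : MapsTo e.symm
      {(⟨m c, mem_image_of_mem m (mem_closedBall_self hr.le)⟩ : ↥(m '' closedBall c r))}ᶜ
      {(⟨c, mem_closedBall_self hr.le⟩ : ↥(closedBall c r))}ᶜ := by
    intro x hx h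
    apply hx
    rw [mem_singleton_iff] at h ⊢
    rw [← e.apply_symm_apply x, h, hec]
  have hBA₁ : MapsTo e.symm.symm {(⟨c, mem_closedBall_self hr.le⟩ : ↥(closedBall c r))}ᶜ
      {(⟨m c, mem_image_of_mem m (mem_closedBall_self hr.le)⟩ : ↥(m '' closedBall c r))}ᶜ := by
    intro v hv h
    apply hv
    rw [mem_singleton_iff] at h ⊢
    rw [Homeomorph.symm_symm] at h
    apply e.injective
    rw [h, hec]
  -- naturality of the transport: `Tη (f_* γ) = gm_* (γ₀)`
  have key := relativeSingularHomology.xEquiv_map ℤ ℤ e.symm η (subsetInclusion hDU) gm hsq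
    hAB₁ hBA₁ hAB hBA hf hgm k γ
  -- `γ₀ = ± (ιV)_* x_c`
  have hι : MapsTo (subsetInclusion (ball_subset_closedBall : ball c r ⊆ closedBall c r))
      {(⟨c, mem_ball_self hr⟩ : ↥(ball c r))}ᶜ {(⟨c, mem_closedBall_self hr.le⟩ : ↥(closedBall c r))}ᶜ :=
    fun v hv h => hv (Subtype.ext (congrArg Subtype.val h :))
  have hγ₀ := eq_or_eq_neg_map_inclusion_ball_of_isGenerator g hr hι
    (exists_linearEquiv_apply_eq_one_of_linearEquiv (relativeSingularHomology.xEquiv ℤ ℤ e.symm hAB₁ hBA₁ k) hγ)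
  -- the transverse germ in box coordinates: `F = gm ∘ ιV`
  have hF : MapsTo (gm.comp (subsetInclusion (ball_subset_closedBall : ball c r ⊆ closedBall c r)))
      {(⟨c, mem_ball_self hr⟩ : ↥(ball c r))}ᶜ
      ((({⟨q, hq⟩} : Set ↥(ball q ρ)) ×ˢ (univ : Set ↥(ball g₁ ρ)))ᶜ) := hgm.comp hι
  have htc : ContinuousOn (fun v => (κ (m v)).1) (ball c r) :=
    (continuous_fst.comp_continuousOn hκm).mono ball_subset_closedBall
  have core := g.map_localClass_of_hasFDerivAt_fst_box isOpen_ball isOpen_ball (mem_ball_self hr)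
    (gm.comp (subsetInclusion (ball_subset_closedBall : ball c r ⊆ closedBall c r)))
    (fun v => (κ (m v)).1) htc (fun _ => rfl) hder hL hmq hq hF
  -- all slices agree
  rw [localHomologyOfSet.map_prodSlice_eq ℤ ℤ ({(⟨q, hq⟩ : ↥(ball q ρ))} : Set ↥(ball q ρ))
    ((gm.comp (subsetInclusion (ball_subset_closedBall : ball c r ⊆ closedBall c r)))
      ⟨c, mem_ball_self hr⟩).2 (⟨g₁, hg₁⟩ : ↥(ball g₁ ρ)) k] at core
  -- assemble: `Tη (f_* γ) = ± slice_* x_q`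
  have hcomp : relativeSingularHomology.map ℤ ℤ gm hgm k
      (relativeSingularHomology.map ℤ ℤ (subsetInclusion ball_subset_closedBall) hι k
        ((localHomology.openSubsetIso ℤ ℤ isOpen_ball (mem_ball_self hr) k).inv (g.localClass c))) =
      relativeSingularHomology.map ℤ ℤ
        (gm.comp (subsetInclusion (ball_subset_closedBall : ball c r ⊆ closedBall c r))) hF k
        ((localHomology.openSubsetIso ℤ ℤ isOpen_ball (mem_ball_self hr) k).inv (g.localClass c)) := by
    rw [← ModuleCat.comp_apply, ← relativeSingularHomology.map_comp]
  have h1 : relativeSingularHomology.xEquiv ℤ ℤ η hAB hBA k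
      (relativeSingularHomology.map ℤ ℤ (subsetInclusion hDU) hf k γ) =
      relativeSingularHomology.map ℤ ℤ
        ((ContinuousMap.id ↥(ball q ρ)).prodMk (ContinuousMap.const ↥(ball q ρ) (⟨g₁, hg₁⟩ : ↥(ball g₁ ρ))))
        (mapsTo_prodSlice_compl_prod {(⟨q, hq⟩ : ↥(ball q ρ))} (⟨g₁, hg₁⟩ : ↥(ball g₁ ρ))) k
        ((localHomology.openSubsetIso ℤ ℤ isOpen_ball hq k).inv (g.localClass q)) ∨
    relativeSingularHomology.xEquiv ℤ ℤ η hAB hBA k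
      (relativeSingularHomology.map ℤ ℤ (subsetInclusion hDU) hf k γ) =
      -relativeSingularHomology.map ℤ ℤ
        ((ContinuousMap.id ↥(ball q ρ)).prodMk (ContinuousMap.const ↥(ball q ρ) (⟨g₁, hg₁⟩ : ↥(ball g₁ ρ))))
        (mapsTo_prodSlice_compl_prod {(⟨q, hq⟩ : ↥(ball q ρ))} (⟨g₁, hg₁⟩ : ↥(ball g₁ ρ))) k
        ((localHomology.openSubsetIso ℤ ℤ isOpen_ball hq k).inv (g.localClass q)) := by
    rw [key]
    -- `gm_* γ₀ = ± gm_* (ιV_* x_c) = ± F_* x_c = ± (± slice_* x_q)`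
    have step := eq_or_eq_neg_map (relativeSingularHomology.map ℤ ℤ gm hgm k).hom hγ₀
    refine eq_or_eq_neg_trans step ?_
    change relativeSingularHomology.map ℤ ℤ gm hgm k
      (relativeSingularHomology.map ℤ ℤ (subsetInclusion ball_subset_closedBall) hι k
        ((localHomology.openSubsetIso ℤ ℤ isOpen_ball (mem_ball_self hr) k).inv (g.localClass c))) = _ ∨ _
    rw [hcomp, core]
    split_ifs
    · exact Or.inl rfl
    · exact Or.inr (map_neg _ _)
  -- pull back along `η` and push to `X`
  have h2 := eq_or_eq_neg_map (relativeSingularHomology.xEquiv ℤ ℤ η hAB hBA k).symm.toLinearMap h1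
  simp only [LinearEquiv.coe_coe, LinearEquiv.symm_apply_apply] at h2
  have h3 := eq_or_eq_neg_map (relativeSingularHomology.map ℤ ℤ (subsetIncl U) hUP k).hom h2
  have hfac : relativeSingularHomology.map ℤ ℤ (subsetIncl (m '' closedBall c r))
      (mapsTo_subsetIncl_parametrizedDisc κ hP m hr (fun v hv => (hmU v hv).1) hmP) k γ =
      relativeSingularHomology.map ℤ ℤ (subsetIncl U) hUP k
        (relativeSingularHomology.map ℤ ℤ (subsetInclusion hDU) hf k γ) := by
    rw [← ModuleCat.comp_apply, ← relativeSingularHomology.map_comp]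
    rfl
  rw [hfac]
  exact h3

/-- **Two transverse discs at the same stratum have the same local class up to sign** (Milnor
1965, PDF p. 50: the coefficient `D_R(p_j) · D` only depends on the transverse intersection;
Bredon 1993, VI.11).  In the setting of `exists_ref_forall_transverseDisc` — a chart `κ`
straightening `P` at the level `q`, a product box `B(q, ρ) × B(g₁, ρ)` in its target — two
parametrized transverse `k`-discs `D = m(B̄(c, r))`, `D' = m'(B̄(c', r'))` in the box (centres on
`P`, possibly different) and generators `γ`, `γ'` of `Hₖ(D | m c; ℤ)`, `Hₖ(D' | m' c'; ℤ)` have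
images in `Hₖ(X | P; ℤ)` which agree up to sign.
[cite: MilnorHCobordism1965, proof of Thm. 7.6 (PDF p. 50); Bredon1993, VI.11] -/
theorem map_generator_eq_or_eq_neg_of_transverseDiscs [T2Space X] {P : Set X}
    (κ : OpenPartialHomeomorph X (EuclideanSpace ℝ (Fin k) × G)) {q : EuclideanSpace ℝ (Fin k)}
    (hP : ∀ x ∈ κ.source, x ∈ P ↔ (κ x).1 = q) {ρ : ℝ} (hρ : 0 < ρ) {g₁ : G}
    (hbox : ball q ρ ×ˢ ball g₁ ρ ⊆ κ.target)
    -- the first disc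
    (m : EuclideanSpace ℝ (Fin k) → X) {c : EuclideanSpace ℝ (Fin k)} {r : ℝ} (hr : 0 < r)
    (hmc : ContinuousOn m (closedBall c r)) (hmi : InjOn m (closedBall c r))
    (hmU : ∀ v ∈ closedBall c r, m v ∈ κ.source ∧ κ (m v) ∈ ball q ρ ×ˢ ball g₁ ρ)
    (hmq : (κ (m c)).1 = q) (hmP : ∀ v ∈ closedBall c r, v ≠ c → (κ (m v)).1 ≠ q)
    {L : EuclideanSpace ℝ (Fin k) →L[ℝ] EuclideanSpace ℝ (Fin k)} (hder : HasFDerivAt (fun v => (κ (m v)).1) L c)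
    (hL : LinearMap.det (L : EuclideanSpace ℝ (Fin k) →ₗ[ℝ] EuclideanSpace ℝ (Fin k)) ≠ 0)
    {γ : localHomology ℤ ℤ ↥(m '' closedBall c r)
      ⟨m c, mem_image_of_mem m (mem_closedBall_self hr.le)⟩ k}
    (hγ : ∃ e : _ ≃ₗ[ℤ] ℤ, e γ = 1)
    -- the second disc
    (m' : EuclideanSpace ℝ (Fin k) → X) {c' : EuclideanSpace ℝ (Fin k)} {r' : ℝ} (hr' : 0 < r')
    (hmc' : ContinuousOn m' (closedBall c' r')) (hmi' : InjOn m' (closedBall c' r'))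
    (hmU' : ∀ v ∈ closedBall c' r', m' v ∈ κ.source ∧ κ (m' v) ∈ ball q ρ ×ˢ ball g₁ ρ)
    (hmq' : (κ (m' c')).1 = q) (hmP' : ∀ v ∈ closedBall c' r', v ≠ c' → (κ (m' v)).1 ≠ q)
    {L' : EuclideanSpace ℝ (Fin k) →L[ℝ] EuclideanSpace ℝ (Fin k)} (hder' : HasFDerivAt (fun v => (κ (m' v)).1) L' c')
    (hL' : LinearMap.det (L' : EuclideanSpace ℝ (Fin k) →ₗ[ℝ] EuclideanSpace ℝ (Fin k)) ≠ 0)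
    {γ' : localHomology ℤ ℤ ↥(m' '' closedBall c' r')
      ⟨m' c', mem_image_of_mem m' (mem_closedBall_self hr'.le)⟩ k}
    (hγ' : ∃ e : _ ≃ₗ[ℤ] ℤ, e γ' = 1) :
    relativeSingularHomology.map ℤ ℤ (subsetIncl (m '' closedBall c r))
        (mapsTo_subsetIncl_parametrizedDisc κ hP m hr (fun v hv => (hmU v hv).1) hmP) k γ =
      relativeSingularHomology.map ℤ ℤ (subsetIncl (m' '' closedBall c' r'))
        (mapsTo_subsetIncl_parametrizedDisc κ hP m' hr' (fun v hv => (hmU' v hv).1) hmP') k γ' ∨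
    relativeSingularHomology.map ℤ ℤ (subsetIncl (m '' closedBall c r))
        (mapsTo_subsetIncl_parametrizedDisc κ hP m hr (fun v hv => (hmU v hv).1) hmP) k γ =
      -relativeSingularHomology.map ℤ ℤ (subsetIncl (m' '' closedBall c' r'))
        (mapsTo_subsetIncl_parametrizedDisc κ hP m' hr' (fun v hv => (hmU' v hv).1) hmP') k γ' := by
  obtain ⟨REF, hREF⟩ := exists_ref_forall_transverseDisc κ hP hρ hbox (k := k)
  exact eq_or_eq_neg_of_common (hREF m c r hr hmc hmi hmU hmq hmP L hder hL γ hγ)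
    (hREF m' c' r' hr' hmc' hmi' hmU' hmq' hmP' L' hder' hL' γ' hγ')

/-! ### The flat discs `κ⁻¹(B̄(q, r) × {g₀})` of a straightening chart are transverse discs -/

omit [NormedSpace ℝ G] in
/-- The flat slice `v ↦ κ⁻¹(v, g₀)` maps the closed ball `B̄(q, r)`, `r < ρ`, `g₀ ∈ B(g₁, ρ)`, into
`source ∩ κ⁻¹(B(q, ρ) × B(g₁, ρ))`. [folklore] -/
theorem flatSlice_mem {κ : OpenPartialHomeomorph X (EuclideanSpace ℝ (Fin k) × G)} {q : EuclideanSpace ℝ (Fin k)} {ρ : ℝ}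
    {g₁ : G} (hbox : ball q ρ ×ˢ ball g₁ ρ ⊆ κ.target) {r : ℝ} (hrρ : r < ρ) {g₀ : G}
    (hg₀ : g₀ ∈ ball g₁ ρ) (v : EuclideanSpace ℝ (Fin k)) (hv : v ∈ closedBall q r) :
    κ.symm (v, g₀) ∈ κ.source ∧ κ (κ.symm (v, g₀)) ∈ ball q ρ ×ˢ ball g₁ ρ := by
  have hvg : (v, g₀) ∈ ball q ρ ×ˢ ball g₁ ρ := ⟨closedBall_subset_ball hrρ hv, hg₀⟩
  exact ⟨κ.map_target (hbox hvg), Set.mem_of_eq_of_mem (κ.right_inv (hbox hvg)) hvg⟩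

omit [NormedSpace ℝ G] in
/-- The first chart coordinate of the flat slice is the identity on `B̄(q, r)`. [folklore] -/
theorem fst_flatSlice {κ : OpenPartialHomeomorph X (EuclideanSpace ℝ (Fin k) × G)} {q : EuclideanSpace ℝ (Fin k)} {ρ : ℝ}
    {g₁ : G} (hbox : ball q ρ ×ˢ ball g₁ ρ ⊆ κ.target) {r : ℝ} (hrρ : r < ρ) {g₀ : G}
    (hg₀ : g₀ ∈ ball g₁ ρ) (v : EuclideanSpace ℝ (Fin k)) (hv : v ∈ closedBall q r) :
    (κ (κ.symm (v, g₀))).1 = v := by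
  have hvg : (v, g₀) ∈ ball q ρ ×ˢ ball g₁ ρ := ⟨closedBall_subset_ball hrρ hv, hg₀⟩
  exact congrArg Prod.fst (κ.right_inv (hbox hvg))

omit [NormedSpace ℝ G] in
/-- The flat slice is continuous on `B̄(q, r)`. [folklore] -/
theorem continuousOn_flatSlice {κ : OpenPartialHomeomorph X (EuclideanSpace ℝ (Fin k) × G)} {q : EuclideanSpace ℝ (Fin k)} {ρ : ℝ}
    {g₁ : G} (hbox : ball q ρ ×ˢ ball g₁ ρ ⊆ κ.target) {r : ℝ} (hrρ : r < ρ) {g₀ : G}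
    (hg₀ : g₀ ∈ ball g₁ ρ) :
    ContinuousOn (fun v : EuclideanSpace ℝ (Fin k) => κ.symm (v, g₀)) (closedBall q r) :=
  κ.continuousOn_symm.comp (Continuous.continuousOn (by fun_prop))
    fun v hv => hbox ⟨closedBall_subset_ball hrρ hv, hg₀⟩

omit [NormedSpace ℝ G] in
/-- The flat slice is injective on `B̄(q, r)`. [folklore] -/
theorem injOn_flatSlice {κ : OpenPartialHomeomorph X (EuclideanSpace ℝ (Fin k) × G)} {q : EuclideanSpace ℝ (Fin k)} {ρ : ℝ}
    {g₁ : G} (hbox : ball q ρ ×ˢ ball g₁ ρ ⊆ κ.target) {r : ℝ} (hrρ : r < ρ) {g₀ : G}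
    (hg₀ : g₀ ∈ ball g₁ ρ) :
    InjOn (fun v : EuclideanSpace ℝ (Fin k) => κ.symm (v, g₀)) (closedBall q r) := by
  intro v hv v' hv' h
  have h1 := congrArg (fun x => (κ x).1) h
  simp only at h1
  rwa [fst_flatSlice hbox hrρ hg₀ v hv, fst_flatSlice hbox hrρ hg₀ v' hv'] at h1

omit [NormedSpace ℝ G] in
/-- Off the centre, the flat slice stays off the level `q`. [folklore] -/
theorem fst_flatSlice_ne {κ : OpenPartialHomeomorph X (EuclideanSpace ℝ (Fin k) × G)} {q : EuclideanSpace ℝ (Fin k)} {ρ : ℝ}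
    {g₁ : G} (hbox : ball q ρ ×ˢ ball g₁ ρ ⊆ κ.target) {r : ℝ} (hrρ : r < ρ) {g₀ : G}
    (hg₀ : g₀ ∈ ball g₁ ρ) (v : EuclideanSpace ℝ (Fin k)) (hv : v ∈ closedBall q r) (hvq : v ≠ q) :
    (κ (κ.symm (v, g₀))).1 ≠ q := by
  rwa [fst_flatSlice hbox hrρ hg₀ v hv]

omit [NormedSpace ℝ G] in
/-- The first chart coordinate of the flat slice has derivative the identity at the centre.
[folklore] -/
theorem hasFDerivAt_fst_flatSlice {κ : OpenPartialHomeomorph X (EuclideanSpace ℝ (Fin k) × G)} {q : EuclideanSpace ℝ (Fin k)} {ρ : ℝ}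
    (hρ : 0 < ρ) {g₁ : G} (hbox : ball q ρ ×ˢ ball g₁ ρ ⊆ κ.target) {g₀ : G}
    (hg₀ : g₀ ∈ ball g₁ ρ) :
    HasFDerivAt (fun v : EuclideanSpace ℝ (Fin k) => (κ (κ.symm (v, g₀))).1) (ContinuousLinearMap.id ℝ (EuclideanSpace ℝ (Fin k))) q := by
  refine (hasFDerivAt_id q).congr_of_eventuallyEq ?_
  filter_upwards [closedBall_mem_nhds q (half_pos hρ)] with v hv
  exact fst_flatSlice hbox (half_lt_self hρ) hg₀ v hv

omit [NormedSpace ℝ G] [TopologicalSpace X] in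
/-- The identity of `ℝᵏ` has nonzero determinant. [folklore] -/
theorem det_id_ne_zero :
    LinearMap.det ((ContinuousLinearMap.id ℝ (EuclideanSpace ℝ (Fin k)) : EuclideanSpace ℝ (Fin k) →L[ℝ] EuclideanSpace ℝ (Fin k)) : EuclideanSpace ℝ (Fin k) →ₗ[ℝ] EuclideanSpace ℝ (Fin k)) ≠ 0 := by
  rw [ContinuousLinearMap.coe_id, LinearMap.det_id]
  exact one_ne_zero

/-- **Flat discs along the stratum have the same local class up to sign** (the slices of a
contractible factor all induce the inverse of the projection, `…StratumLocalHomology`): for a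
chart `κ` straightening `P` at the level `q` and a box `B(q, ρ) × B(g₁, ρ)` in its target, the
flat discs `κ⁻¹(B̄(q, r) × {g₀})`, `κ⁻¹(B̄(q, r') × {g₀'})` (`r, r' < ρ`, `g₀, g₀' ∈ B(g₁, ρ)`)
through the points `κ⁻¹(q, g₀)`, `κ⁻¹(q, g₀')` of `P` and generators of their local homology at
these points have images in `Hₖ(X | P; ℤ)` which agree up to sign. [cite: HatcherAT2002, §3.3 p. 231; Bredon1993, VI.11] -/
theorem map_generator_eq_or_eq_neg_of_flatDiscs [T2Space X] {P : Set X}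
    (κ : OpenPartialHomeomorph X (EuclideanSpace ℝ (Fin k) × G)) {q : EuclideanSpace ℝ (Fin k)}
    (hP : ∀ x ∈ κ.source, x ∈ P ↔ (κ x).1 = q) {ρ : ℝ} (hρ : 0 < ρ) {g₁ : G}
    (hbox : ball q ρ ×ˢ ball g₁ ρ ⊆ κ.target)
    {r : ℝ} (hr : 0 < r) (hrρ : r < ρ) {g₀ : G} (hg₀ : g₀ ∈ ball g₁ ρ)
    {γ : localHomology ℤ ℤ ↥((fun v : EuclideanSpace ℝ (Fin k) => κ.symm (v, g₀)) '' closedBall q r)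
      ⟨κ.symm (q, g₀), mem_image_of_mem (fun v : EuclideanSpace ℝ (Fin k) => κ.symm (v, g₀)) (mem_closedBall_self hr.le)⟩ k}
    (hγ : ∃ e : _ ≃ₗ[ℤ] ℤ, e γ = 1)
    {r' : ℝ} (hr' : 0 < r') (hrρ' : r' < ρ) {g₀' : G} (hg₀' : g₀' ∈ ball g₁ ρ)
    {γ' : localHomology ℤ ℤ ↥((fun v : EuclideanSpace ℝ (Fin k) => κ.symm (v, g₀')) '' closedBall q r')
      ⟨κ.symm (q, g₀'), mem_image_of_mem (fun v : EuclideanSpace ℝ (Fin k) => κ.symm (v, g₀')) (mem_closedBall_self hr'.le)⟩ k}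
    (hγ' : ∃ e : _ ≃ₗ[ℤ] ℤ, e γ' = 1) :
    relativeSingularHomology.map ℤ ℤ (subsetIncl ((fun v : EuclideanSpace ℝ (Fin k) => κ.symm (v, g₀)) '' closedBall q r))
        (mapsTo_subsetIncl_parametrizedDisc κ hP (fun v : EuclideanSpace ℝ (Fin k) => κ.symm (v, g₀)) hr
          (fun v hv => (flatSlice_mem hbox hrρ hg₀ v hv).1) (fst_flatSlice_ne hbox hrρ hg₀)) k γ =
      relativeSingularHomology.map ℤ ℤ (subsetIncl ((fun v : EuclideanSpace ℝ (Fin k) => κ.symm (v, g₀')) '' closedBall q r'))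
        (mapsTo_subsetIncl_parametrizedDisc κ hP (fun v : EuclideanSpace ℝ (Fin k) => κ.symm (v, g₀')) hr'
          (fun v hv => (flatSlice_mem hbox hrρ' hg₀' v hv).1) (fst_flatSlice_ne hbox hrρ' hg₀')) k γ' ∨
    relativeSingularHomology.map ℤ ℤ (subsetIncl ((fun v : EuclideanSpace ℝ (Fin k) => κ.symm (v, g₀)) '' closedBall q r))
        (mapsTo_subsetIncl_parametrizedDisc κ hP (fun v : EuclideanSpace ℝ (Fin k) => κ.symm (v, g₀)) hr
          (fun v hv => (flatSlice_mem hbox hrρ hg₀ v hv).1) (fst_flatSlice_ne hbox hrρ hg₀)) k γ =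
      -relativeSingularHomology.map ℤ ℤ (subsetIncl ((fun v : EuclideanSpace ℝ (Fin k) => κ.symm (v, g₀')) '' closedBall q r'))
        (mapsTo_subsetIncl_parametrizedDisc κ hP (fun v : EuclideanSpace ℝ (Fin k) => κ.symm (v, g₀')) hr'
          (fun v hv => (flatSlice_mem hbox hrρ' hg₀' v hv).1) (fst_flatSlice_ne hbox hrρ' hg₀')) k γ' :=
  map_generator_eq_or_eq_neg_of_transverseDiscs κ hP hρ hbox
    (fun v : EuclideanSpace ℝ (Fin k) => κ.symm (v, g₀)) hr (continuousOn_flatSlice hbox hrρ hg₀)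
    (injOn_flatSlice hbox hrρ hg₀) (flatSlice_mem hbox hrρ hg₀)
    (fst_flatSlice hbox hrρ hg₀ q (mem_closedBall_self hr.le)) (fst_flatSlice_ne hbox hrρ hg₀)
    (hasFDerivAt_fst_flatSlice hρ hbox hg₀) det_id_ne_zero hγ
    (fun v : EuclideanSpace ℝ (Fin k) => κ.symm (v, g₀')) hr' (continuousOn_flatSlice hbox hrρ' hg₀')
    (injOn_flatSlice hbox hrρ' hg₀') (flatSlice_mem hbox hrρ' hg₀')
    (fst_flatSlice hbox hrρ' hg₀' q (mem_closedBall_self hr'.le)) (fst_flatSlice_ne hbox hrρ' hg₀')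
    (hasFDerivAt_fst_flatSlice hρ hbox hg₀') det_id_ne_zero hγ'

end Charts

end Literature.AlgebraicTopology.SingularHomology

end
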